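import Summits.QuantumFields.BalabanUV.Beta.GAN24.HalfReadout

/-!
# `BalabanUV.Beta.GAN24.SecondResponseReadout` — row G-an2-4 ∕ (CONV-C), W-slot, road «W3» (SKELETON-W3 §7.2 ∕ §8.3 (F2)), «W3-S3C*» PART 6
# module (B1): THE READ-OUT OF `K ∘ dM K′ ∘ K` FOR A KERNEL `K′` BI-LOCALISED AT ONE CENTRE, AND THE SECOND-RESPONSE CHANNEL OF THE BRACKET
# IN THE FIRST-BOND (SWAPPED) ORIENTATION — `Σ'_{u′} Σ'_{x′} Σ'_{z′} mmRead N (K ∘ dM (K2OfK K N S M κ u) N S M κ′ u′ ∘ K) x′ z′ (inl α) (inl β) = 0`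
# at EVERY first bond `(κ, u)` (leaf-16's pointwise transversal form), for a generic packed kernel `K` (decay, site-free coarse-leg charges
# vanishing on multiplier legs), a generic local stencil family `S` carrying (S3c) (legs pair) as a HYPOTHESIS, a block-covariant vertex family `M`

NOT IN PRINT; OUR BOOKKEEPING (idle-seat kernel lemma, unit `b2b-balaban-gan24-formalise-leaf-06`, gen 9).  HONEST FRAMING (cell contract,
verbatim): «discharging `BetaPertH` makes Bałaban's UV stability UNCONDITIONAL — a real constructive-QFT result; it is NOT the continuum limit and
NOT the Clay problem.»  HONEST DEPENDENCY (verbatim): «continuum YM on T⁴ ⇐ BetaPertH ∧ nine spine estimates (0/9 proved); BetaPertH ⇐ (D1) ∧ (D4)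
∧ CAP+tail; G-an2-4 gates asym, D1 and NE2/3/4.»

WHY (the located use).  ROW W3-F2a reads `∀ m, Zfree (b m)` for leaf-04's bracket; through `K3OfK`'s third summand `−K♮∘W♮⁰∘K♮` with
`W♮⁰ = W2SymOfK K♮ Lc S♮ M♮ 0 M₂♮ = ½(1 + swap) W2OfK …` the bracket carries, besides the two MIXED terms (leaf-14's `MixedChannelZeroMode`) and
the bi-vertex of the ZERO table (`T2RecursionAffine.vertex2OfK_zero`), the SECOND-RESPONSE PIECE `dM (K2OfK K N S M ν y′) N S M μ y` of
`SecondOrderResponse.W2OfK_apply` in both bond orders (SKELETON-W3 §7.2: «Z of the second-response piece dM(K2OfK K̃ S̃ M̃ c′)(S̃,M̃)(c) read on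
(c″,c‴) = −E3_m[c_q, c̃″, c̃‴] = 0 ((S3c), c_q := K̃^{fm}q constant by (Q-lin))»).  This file is that sentence at kernel level, generic `d`, `N ≥ 1`:
* §1 bookkeeping: `tsum_readout_eq` (only field–field charges survive a read-out value), `tsum_prod_swap`.
* §2 **`hasSum_legs_dM_of_biLoc`** ∕ **`inner_readout_dM_of_biLoc`**: for ANY kernel `K′` bi-localised at one centre, the read-out of
  `K ∘ dM K′ N S M ν u′ ∘ K` is `Σ_{a,b} ρL(inl a) ρR(inl b) Σ_ρ (Σ'_w colM K′ N ν u′ ρ w) · (Σ' M ρ 0)_{ab}` — the chain-rule vertex dies on two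
  constant kernel legs ((S3c) legs pair, module (A)), only the multiplier-column POSITION masses of `K′` survive.
* §3 **`inner_resp_swap_eq_zero`** (first-bond orientation, `K′ = K2OfK K N S M κ u` FIXED): its column masses summed over the free bond are the
  read-out of `−K ∘ dM_{(κ,u)} ∘ K` on two multiplier charges = `Σ ρLρR · (dM_{(κ,u)} on two constant kernel legs) = 0` (module (A) `hasSum_dM_legs_ff`).
The second-bond orientation (`K′ = K2OfK K N S M κ′ u′` RUNNING with the summed bond) is module (B2) `SecondResponseZeroMode`.
[folklore] Fubini ∕ re-indexing over tree objects BY NAME (gen 8's `hasSum_sandwich_readout`, an2's `vertexFamily_K2OfK` ∕ `vertexFamily_dM`,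
an5's `comp_assoc_tame`, module (A)); asserts NO shape or value of Bałaban's tables, pins no colour constant; discharges NOTHING of ROW W3-F2a ∕
F2b, «T2Shape» ∕ «T2SupRate», (hW, hWall); 0 wall binders; NOT «W-slot closed», NEVER «G-an2-4 closed»; NOT BetaPertH, NOT continuum, NOT Clay.
0 `def`, 0 cite, 0 sorry.
-/

noncomputable section

open Finset
open scoped BigOperators
open Literature.MathematicalPhysics.QuantumFieldTheory
open Literature.MathematicalPhysics.QuantumFieldTheory.Balaban1983to89
open Literature.MathematicalPhysics.QuantumFieldTheory.Balaban1983to89.Beta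
open Literature.Probability.LatticeModels (Torus.proj)
open B12Sec2to5 (l1 l1_nonneg)
open ExpKernelCalculus (Site MKer BiLoc Decays VertexFamily comp shiftK Zl Zl_nonneg summable_exp_shift' tsum_exp_shift' l1_sub_triangle
  l1_sub_symm)
open OneStepResolventKernel (Fib LocStencil decays_mono biLoc_mono)
open OneStepKernelFamily (colH vertexOfK)
open SecondOrderResponse (colM vertexOfM dM dM_apply K2OfK cK2 vertexFamily_dM vertexFamily_K2OfK)
open BalabanStepJets (locStencil_mono)
open BalabanStepJetsSucc (mmRead mmRead_inl_inl biLoc_comp_right)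
open Summit.QuantumFields.BalabanUV.Beta.TameKernelCalculus (Spr Loc comp_assoc_tame)
open Summit.QuantumFields.BalabanUV.Beta.GAN24.KernelLegCharges (summable_exp_coarse summable_prod_of_biLoc)
open Summit.QuantumFields.BalabanUV.Beta.GAN24.ResolventLegCharges (hasSum_sandwich_readout)
open Summit.QuantumFields.BalabanUV.Beta.GAN24.DMBondCharges (hasSum_fibre_swap decays_of_biLoc hasSum_dM_bond summable_tableSum_leg1
  hasSum_tableSum_leg1 tableSum_periodic hasSum_collapse_left hasSum_vertexOfK_legs hasSum_vertexOfM_legs hasSum_dM_legs_ff)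
open Summit.QuantumFields.BalabanUV.Beta.GAN24.HalfReadout (hasSum_halfReadout_left)

namespace Summit.QuantumFields.BalabanUV.Beta.GAN24.SecondResponseReadout

variable {d : ℕ}

/-! ## §1 Bookkeeping -/

/-- [folklore] **ONLY FIELD–FIELD CHARGES SURVIVE A READ-OUT VALUE**: for charges vanishing on the multiplier legs and a kernel with summable
double-leg families, `Σ'_{(y,w)} Σ_{f,g} cL f · V y w f g · cR g = Σ_{a,b} cL (inl a) cR (inl b) · Σ'_{(y,w)} V y w (inl a) (inl b)`. -/
theorem tsum_readout_eq {V : MKer (d + 1) (Fib d)} {cL cR : Fib d → ℝ} (hL : ∀ μ, cL (Sum.inr μ) = 0) (hR : ∀ μ, cR (Sum.inr μ) = 0)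
    (hV : ∀ f g, Summable fun yw : Site (d + 1) × Site (d + 1) => V yw.1 yw.2 f g) :
    (∑' yw : Site (d + 1) × Site (d + 1), ∑ f, ∑ g, cL f * V yw.1 yw.2 f g * cR g)
      = ∑ a : Fin (d + 1), ∑ b : Fin (d + 1), cL (Sum.inl a) * cR (Sum.inl b) *
          ∑' yw : Site (d + 1) × Site (d + 1), V yw.1 yw.2 (Sum.inl a) (Sum.inl b) := by
  have hs : ∀ f g, Summable fun yw : Site (d + 1) × Site (d + 1) => cL f * V yw.1 yw.2 f g * cR g :=
    fun f g => ((hV f g).mul_left (cL f)).mul_right (cR g)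
  rw [Summable.tsum_finsetSum (fun f _ => summable_sum fun g _ => hs f g)]
  have e1 : ∀ f, ∑' yw : Site (d + 1) × Site (d + 1), ∑ g, cL f * V yw.1 yw.2 f g * cR g
      = ∑ g, cL f * cR g * ∑' yw : Site (d + 1) × Site (d + 1), V yw.1 yw.2 f g := by
    intro f
    rw [Summable.tsum_finsetSum (fun g _ => hs f g)]
    refine Finset.sum_congr rfl fun g _ => ?_
    rw [tsum_mul_right, tsum_mul_left]
    ring
  simp_rw [e1]
  rw [Fintype.sum_sum_type]
  have hr : ∑ μ : Fin (d + 1), ∑ g, cL (Sum.inr μ) * cR g * ∑' yw : Site (d + 1) × Site (d + 1), V yw.1 yw.2 (Sum.inr μ) g = 0 :=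
    Finset.sum_eq_zero fun μ _ => Finset.sum_eq_zero fun g _ => by rw [hL μ, zero_mul, zero_mul]
  rw [hr, add_zero]
  refine Finset.sum_congr rfl fun a _ => ?_
  rw [Fintype.sum_sum_type]
  have hr' : ∑ μ : Fin (d + 1), cL (Sum.inl a) * cR (Sum.inr μ) *
      ∑' yw : Site (d + 1) × Site (d + 1), V yw.1 yw.2 (Sum.inl a) (Sum.inr μ) = 0 :=
    Finset.sum_eq_zero fun μ _ => by rw [hR μ, mul_zero, zero_mul]
  rw [hr', add_zero]

/-- [folklore] Both iterated orders of an absolutely convergent double family agree. -/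
theorem tsum_prod_swap {F : Site (d + 1) × Site (d + 1) → ℝ} (h : Summable F) :
    (∑' q, ∑' y, F (q, y)) = ∑' y, ∑' q, F (q, y) := by
  have h3 : ∑' p : Site (d + 1) × Site (d + 1), F p.swap = ∑' p, F p := (Equiv.prodComm _ _).tsum_eq F
  rw [← h.tsum_prod, ← h3, h.prod_symm.tsum_prod]
  simp only [Prod.swap_prod_mk]

variable {N : ℕ} [NeZero N]
variable {K : MKer (d + 1) (Fib d)} {C m : ℝ} {ρL ρR : Fin (d + 1) → Fib d → ℝ}
  {S : Fin (d + 1) → Site (d + 1) → MKer (d + 1) (Fib d)} {Cs : ℝ}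
  {M : Fin (d + 1) → Site (d + 1) → MKer (d + 1) (Fib d)} {CM : ℝ}

/-! ## §2 The read-out of `K ∘ dM K′ ∘ K` for a kernel `K′` bi-localised at one centre -/

/-- [folklore] **an2's `dM` THROUGH A BI-LOCALISED KERNEL, ON TWO CONSTANT KERNEL LEGS**: for ANY `K′` bi-localised at one centre (rate `m`),
the chain-rule vertex dies ((S3c) legs pair) and the multiplier vertex leaves its column POSITION masses against the common double-leg sum of
the block-covariant `M`: `HasSum ((v,p) ↦ dM K′ N S M ν u′ v p (inl a) (inl b)) (Σ_ρ (Σ'_w colM K′ N ν u′ ρ w) · Σ'_{(v,p)} M ρ 0 v p (inl a) (inl b))`. -/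
theorem hasSum_legs_dM_of_biLoc (hm : 0 < m) (hS : LocStencil S Cs m)
    (hS0 : ∀ (κ : Fin (d + 1)) (t : Site (d + 1)) (a b : Fin (d + 1)),
      HasSum (fun vp : Site (d + 1) × Site (d + 1) => S κ t vp.1 vp.2 (Sum.inl a) (Sum.inl b)) 0)
    (hM : VertexFamily M N CM m) (hMt : ∀ (ρ : Fin (d + 1)) (w t : Site (d + 1)), M ρ (w + t) = shiftK (-((N : ℤ) • t)) (M ρ w))
    {K' : MKer (d + 1) (Fib d)} {C' : ℝ} {c₀ : Site (d + 1)} (hK' : BiLoc K' c₀ c₀ C' m) (ν : Fin (d + 1)) (u' : Site (d + 1))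
    (a b : Fin (d + 1)) :
    HasSum (fun vp : Site (d + 1) × Site (d + 1) => dM K' N S M ν u' vp.1 vp.2 (Sum.inl a) (Sum.inl b))
      (∑ ρ : Fin (d + 1), (∑' w : Site (d + 1), colM K' N ν u' ρ w) *
        ∑' vp : Site (d + 1) × Site (d + 1), M ρ 0 vp.1 vp.2 (Sum.inl a) (Sum.inl b)) := by
  have hC' : 0 ≤ C' := hK'.nonneg (Sum.inl 0)
  have hw1 : ∀ (κ : Fin (d + 1)) (t : Site (d + 1)), |colH K' N ν u' κ t| ≤ C' * Real.exp (-m * l1 (t - c₀)) := by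
    intro κ t
    refine (hK' t ((N : ℤ) • u') (Sum.inl κ) (Sum.inr ν)).trans (mul_le_mul_of_nonneg_left ?_ hC')
    rw [Real.exp_le_exp]
    nlinarith [l1_nonneg (t - c₀), l1_nonneg ((N : ℤ) • u' - c₀)]
  have hw2 : ∀ (ρ : Fin (d + 1)) (w : Site (d + 1)), |colM K' N ν u' ρ w| ≤ C' * Real.exp (-m * l1 ((N : ℤ) • w - c₀)) := by
    intro ρ w
    refine (hK' ((N : ℤ) • w) ((N : ℤ) • u') (Sum.inr ρ) (Sum.inr ν)).trans (mul_le_mul_of_nonneg_left ?_ hC')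
    rw [Real.exp_le_exp]
    nlinarith [l1_nonneg ((N : ℤ) • w - c₀), l1_nonneg ((N : ℤ) • u' - c₀)]
  have h1 := hasSum_vertexOfK_legs (N := N) hm ν u' hw1 hS hS0 a b
  have h2 := hasSum_vertexOfM_legs hm ν u' hw2 hM hMt (Sum.inl a) (Sum.inl b)
  have h := h1.add h2
  rw [zero_add] at h
  exact h.congr_fun fun vp => by rw [dM_apply]

/-- [folklore] **THE READ-OUT OF `K ∘ dM K′ N S M ν u′ ∘ K`** for a kernel `K′` bi-localised at one centre, in the transversal currency:
`Σ'_{x′} Σ'_{z′} mmRead N (K ∘ dM K′ … ν u′ ∘ K) x′ z′ (inl α) (inl β) = Σ_{a,b} ρL α (inl a) · ρR β (inl b) · Σ_ρ (Σ'_w colM K′ N ν u′ ρ w) ·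
Σ'_{(v,p)} M ρ 0 v p (inl a) (inl b)` — only the multiplier-column POSITION masses of `K′` survive. -/
theorem inner_readout_dM_of_biLoc (hK : Decays K C m) (hm : 0 < m)
    (hrow : ∀ α f y, HasSum (fun x' : Site (d + 1) => K ((N : ℤ) • x') y (Sum.inr α) f) (ρL α f))
    (hcol : ∀ β g w, HasSum (fun z' : Site (d + 1) => K w ((N : ℤ) • z') g (Sum.inr β)) (ρR β g))
    (hL0 : ∀ α μ, ρL α (Sum.inr μ) = 0) (hR0 : ∀ β μ, ρR β (Sum.inr μ) = 0) (hS : LocStencil S Cs m)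
    (hS0 : ∀ (κ : Fin (d + 1)) (t : Site (d + 1)) (a b : Fin (d + 1)),
      HasSum (fun vp : Site (d + 1) × Site (d + 1) => S κ t vp.1 vp.2 (Sum.inl a) (Sum.inl b)) 0)
    (hM : VertexFamily M N CM m) (hMt : ∀ (ρ : Fin (d + 1)) (w t : Site (d + 1)), M ρ (w + t) = shiftK (-((N : ℤ) • t)) (M ρ w))
    {K' : MKer (d + 1) (Fib d)} {C' : ℝ} {c₀ : Site (d + 1)} (hK' : BiLoc K' c₀ c₀ C' m) (ν : Fin (d + 1)) (u' : Site (d + 1))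
    (α β : Fin (d + 1)) :
    (∑' x', ∑' z', mmRead N (comp (comp K (dM K' N S M ν u')) K) x' z' (Sum.inl α) (Sum.inl β))
      = ∑ a : Fin (d + 1), ∑ b : Fin (d + 1), ρL α (Sum.inl a) * ρR β (Sum.inl b) *
          ∑ ρ : Fin (d + 1), (∑' w : Site (d + 1), colM K' N ν u' ρ w) *
            ∑' vp : Site (d + 1) × Site (d + 1), M ρ 0 vp.1 vp.2 (Sum.inl a) (Sum.inl b) := by
  have hC' : 0 ≤ C' := hK'.nonneg (Sum.inl 0)
  have hK'd : Decays K' C' m := decays_of_biLoc hK' hm.le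
  have hVb := (vertexFamily_dM (N := N) hK'd hC' hS hM hm le_rfl) ν u'
  have hread := hasSum_sandwich_readout hK hm hVb (half_pos hm) α β (hrow α) (hcol β)
  have hpair : (∑' x', ∑' z', mmRead N (comp (comp K (dM K' N S M ν u')) K) x' z' (Sum.inl α) (Sum.inl β))
      = ∑' xz : Site (d + 1) × Site (d + 1),
          comp (comp K (dM K' N S M ν u')) K ((N : ℤ) • xz.1) ((N : ℤ) • xz.2) (Sum.inr α) (Sum.inr β) := by
    simp only [mmRead_inl_inl]
    exact (hread.summable.tsum_prod).symm
  rw [hpair, hread.tsum_eq, tsum_readout_eq (hL0 α) (hR0 β) (fun f g => summable_prod_of_biLoc hVb (half_pos hm) f g)]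
  refine Finset.sum_congr rfl fun a _ => Finset.sum_congr rfl fun b _ => ?_
  rw [(hasSum_legs_dM_of_biLoc hm hS hS0 hM hMt hK' ν u' a b).tsum_eq]

/-! ## §3 First-bond (swapped) orientation: `K′ = K2OfK K N S M κ u` fixed -/

/-- [folklore] **THE SECOND-RESPONSE CHANNEL HAS ZERO ff ZERO MODE — first-bond (swapped) orientation, pointwise transversal form.**
For a packed kernel `K` (decay `m > 0`; site-free coarse-leg charges `ρL α`, `ρR β` vanishing on the multiplier legs — so (Q-lin) on the field
legs and (S2c) on the multiplier legs), a local stencil family `S` with the (S3c) legs-pair sum rule, and a block-covariant vertex family `M`: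
for EVERY first bond `(κ, u)`, `Σ'_{u′} Σ'_{x′} Σ'_{z′} mmRead N (K ∘ dM (K2OfK K N S M κ u) N S M κ′ u′ ∘ K) x′ z′ (inl α) (inl β) = 0`. -/
theorem inner_resp_swap_eq_zero (hK : Decays K C m) (hm : 0 < m)
    (hrow : ∀ α f y, HasSum (fun x' : Site (d + 1) => K ((N : ℤ) • x') y (Sum.inr α) f) (ρL α f))
    (hcol : ∀ β g w, HasSum (fun z' : Site (d + 1) => K w ((N : ℤ) • z') g (Sum.inr β)) (ρR β g))
    (hL0 : ∀ α μ, ρL α (Sum.inr μ) = 0) (hR0 : ∀ β μ, ρR β (Sum.inr μ) = 0) (hS : LocStencil S Cs m)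
    (hS0 : ∀ (κ : Fin (d + 1)) (t : Site (d + 1)) (a b : Fin (d + 1)),
      HasSum (fun vp : Site (d + 1) × Site (d + 1) => S κ t vp.1 vp.2 (Sum.inl a) (Sum.inl b)) 0)
    (hM : VertexFamily M N CM m) (hMt : ∀ (ρ : Fin (d + 1)) (w t : Site (d + 1)), M ρ (w + t) = shiftK (-((N : ℤ) • t)) (M ρ w))
    (κ : Fin (d + 1)) (u : Site (d + 1)) (κ' α β : Fin (d + 1)) :
    (∑' u', ∑' x', ∑' z', mmRead N (comp (comp K (dM (K2OfK K N S M κ u) N S M κ' u')) K) x' z' (Sum.inl α) (Sum.inl β)) = 0 := by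
  have hC : 0 ≤ C := hK.nonneg (Sum.inl 0)
  have hCs : 0 ≤ Cs := (hS 0 0).nonneg (Sum.inl 0)
  have hCM : 0 ≤ CM := (hM 0 0).nonneg (Sum.inl 0)
  have hm8 : 0 < m / 8 := by positivity
  have hK2 : BiLoc (K2OfK K N S M κ u) ((N : ℤ) • u) ((N : ℤ) • u) (cK2 d C Cs CM m) (m / 8) := vertexFamily_K2OfK hK hC hm hS hM κ u
  have hK8 : Decays K C (m / 8) := decays_mono hK hC le_rfl (by linarith)
  have hS8 : LocStencil S Cs (m / 8) := locStencil_mono hS hCs (by linarith)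
  have hM8 : VertexFamily M N CM (m / 8) := fun ρ w => biLoc_mono (hM ρ w) hCM (by linarith)
  have hval : ∀ u' : Site (d + 1),
      (∑' x', ∑' z', mmRead N (comp (comp K (dM (K2OfK K N S M κ u) N S M κ' u')) K) x' z' (Sum.inl α) (Sum.inl β))
        = ∑ a : Fin (d + 1), ∑ b : Fin (d + 1), ρL α (Sum.inl a) * ρR β (Sum.inl b) *
            ∑ ρ : Fin (d + 1), (∑' w : Site (d + 1), colM (K2OfK K N S M κ u) N κ' u' ρ w) *
              ∑' vp : Site (d + 1) × Site (d + 1), M ρ 0 vp.1 vp.2 (Sum.inl a) (Sum.inl b) :=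
    fun u' => inner_readout_dM_of_biLoc hK8 hm8 hrow hcol hL0 hR0 hS8 hS0 hM8 hMt hK2 κ' u' α β
  simp_rw [hval]
  -- the multiplier columns of `K` have zero position mass ((S2c), from the row charges)
  have hK0' : ∀ (μ ρ : Fin (d + 1)) (y : Site (d + 1)), HasSum (fun w : Site (d + 1) => colM K N μ y ρ w) 0 := by
    intro μ ρ y
    have h := hrow ρ (Sum.inr μ) ((N : ℤ) • y)
    rwa [hL0] at h
  -- the bond series of the multiplier-column position masses of `K2OfK … κ u` sums to zero
  have hcm : ∀ ρ : Fin (d + 1), HasSum (fun u' : Site (d + 1) => ∑' w : Site (d + 1), colM (K2OfK K N S M κ u) N κ' u' ρ w) 0 := by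
    intro ρ
    have hVb := (vertexFamily_dM (N := N) hK hC hS hM hm le_rfl) κ u
    have hsand := hasSum_sandwich_readout hK hm hVb (half_pos hm) ρ κ' (hrow ρ) (hcol κ')
    have hR : (∑' yw : Site (d + 1) × Site (d + 1), ∑ f, ∑ g, ρL ρ f * dM K N S M κ u yw.1 yw.2 f g * ρR κ' g) = 0 := by
      rw [tsum_readout_eq (hL0 ρ) (hR0 κ') (fun f g => summable_prod_of_biLoc hVb (half_pos hm) f g)]
      refine Finset.sum_eq_zero fun a _ => Finset.sum_eq_zero fun b _ => ?_
      rw [(hasSum_dM_legs_ff hK hm hK0' hS hS0 hM hMt κ u a b).tsum_eq, mul_zero]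
    rw [hR] at hsand
    have hG : HasSum (fun wu : Site (d + 1) × Site (d + 1) => colM (K2OfK K N S M κ u) N κ' wu.2 ρ wu.1) 0 := by
      have h := hsand.neg
      rw [neg_zero] at h
      exact h.congr_fun fun wu => by simp only [colM, K2OfK]
    have h := hasSum_fibre_swap hG.summable (fun w => (hG.summable.prod_factor w).hasSum)
    rwa [← hG.summable.tsum_prod, hG.tsum_eq] at h
  have h := hasSum_sum (s := (Finset.univ : Finset (Fin (d + 1)))) fun a _ =>
    hasSum_sum (s := (Finset.univ : Finset (Fin (d + 1)))) fun b _ =>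
      (hasSum_sum (s := (Finset.univ : Finset (Fin (d + 1)))) fun ρ _ =>
        (hcm ρ).mul_right (∑' vp : Site (d + 1) × Site (d + 1), M ρ 0 vp.1 vp.2 (Sum.inl a) (Sum.inl b))).mul_left
          (ρL α (Sum.inl a) * ρR β (Sum.inl b))
  simp only [zero_mul, Finset.sum_const_zero, mul_zero] at h
  exact h.tsum_eq

end Summit.QuantumFields.BalabanUV.Beta.GAN24.SecondResponseReadout

end
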